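import Summits.BirchSwinnertonDyer.BirchSwinnertonDyer.Theorems.ManinLocalTwoThreeNewformPinningSixtyThree
import Summits.BirchSwinnertonDyer.BirchSwinnertonDyer.Theorems.ManinLocalTwoThreeBracketSturmSixtyThree
import Summits.BirchSwinnertonDyer.BirchSwinnertonDyer.Theorems.ManinLocalTwoThreeExistsMinimalOptimalDatum
import HarnessLib

/-!
# Level 63: `|c| = 1` — hence `3 ∤ c` — for EVERY lattice-optimal `X₀(63)`-datum of EVERY globally minimal elliptic curve over `ℚ`, UNCONDITIONALLY
# (C3 domain, `9 ∥ 63`, genus 5; the newform `63a` pinned by the FRICKE SIEVE)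

Cell bsd-f2-manin, route `ManinLocalTwoThree` (crux C3 `ManinPrimeToThreeAtNine`, stmt-22968: `3² ∣ 63`), prover seat p2 gen 29; `--supports` (helper).
ASSEMBLY of the level-`63` programme: the twelve `η`-quotient forms `C1, …, C12` of the `σ`-closed basis with their kernel tables and Fricke rows
(`…EtaTablesSixtyThree{A,B,C}`) instantiate the abstract pinning `f_toModularForm_eq_sixtyThree_of_basis` (`…NewformPinningSixtyThree`: `M₂`-linear algebra,
curve recursion, Fricke sieve), whence **`⇑D.f = Σ xᵢCᵢ` for EVERY `X₀(63)`-datum** (`f_apply_eq_sixtyThree`), and the Bracket–Sturm certificate of `63a`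
(`…BracketSturmSixtyThree.abs_maninConstant_eq_one_sixtyThree_of_pinned`) gives **`|c| = 1` and `3 ∤ c` on `X₀(63)`**; the domain is inhabited under
the item's binder `exists_isNewformOf` (`N(63a1) = 63` by kernel Tate certificate).  HONEST FRAMING: unconditional (standard axioms); one level of C3 —
nothing here proves C3 for all `N`, Manin's conjecture or BSD. [cite: AtkinLehner1970, Thm. 3, Thm. 5] [cite: Manin1972, Prop. 1.4] [cite: Sturm1987, Thm. 1]
[cite: AgasheRibetStein2006, §§1–2] [cite: CremonaAlgorithms1997, §2.10, Table 1 (63a1), Table 3 (N = 63)] [cite: EdixhovenManin1991, Prop. 2]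
-/

set_option autoImplicit false
-- lint-debt: the directory name repeats the summit name (sibling precedent `ManinLocalTwoThreeManinConstantFortyFive.lean`)
set_option linter.dupNamespace false

noncomputable section

open Complex Filter Topology Set Function
open UpperHalfPlane hiding I
open scoped Real Topology MatrixGroups ModularForm
open ModularForm CongruenceSubgroup
open Literature.NumberTheory.ModularForms
open Literature.NumberTheory.EllipticCurves Literature.NumberTheory.EllipticCurves.ModularForms
open Literature.NumberTheory.Automorphic

namespace Summit.BirchSwinnertonDyer.BirchSwinnertonDyer.Theorems.ManinLocalTwoThree.LevelSixtyThree

/-! ## §1 Reading columns off certified tables -/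

/-- A `q`-coefficient of a form read off its certified integer table. [folklore] -/
theorem coeff_of_table {E : ℍ → ℂ} {e : List ℤ} (he : ∀ n < 97, ((e.getD n 0 : ℤ) : ℂ) = (qExpansion 1 E).coeff n)
    (n : ℕ) (hn : n < 97) (v : ℤ) (hv : e.getD n 0 = v) : (qExpansion 1 E).coeff n = (v : ℂ) := by
  rw [← hv]
  exact (he n hn).symm

/-! ## §2 The pinning instantiated: `⇑D.f = Σ xᵢCᵢ` for every `X₀(63)`-datum -/

variable {W : WeierstrassCurve ℚ} [W.IsElliptic]

/-- **THE NEWFORM OF EVERY `X₀(63)`-DATUM, AS A FUNCTION: `⇑D.f = Σ xᵢCᵢ`**, `x = (−2, −2, 16, 0, 0, −54, −14, −12, −49, −7, −8, 16)` on the `σ`-closed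
`η`-basis — FACT-FREE. [cite: AtkinLehner1970, Thm. 3, Thm. 5] [cite: CremonaAlgorithms1997, Table 3 (N = 63)] -/
theorem f_apply_eq_sixtyThree (D : ModularParametrizationData W 63) :
    ⇑D.f = (fun τ ↦ -2 * etaQuotient 63 (expFn [(1, -2), (3, 6), (7, 2), (9, -2), (21, -2), (63, 2)]) τ - 2 * etaQuotient 63 (expFn [(1, 2), (3, -2), (7, -2), (9, 2), (21, 6), (63, -2)]) τ + 16 * etaQuotient 63 (expFn [(1, -1), (3, 2), (7, 1), (9, 1), (21, 2), (63, -1)]) τ - 54 * etaQuotient 63 (expFn [(3, -2), (9, 6)]) τ - 14 * etaQuotient 63 (expFn [(7, 6), (21, -2)]) τ - 12 * etaQuotient 63 (expFn [(3, -1), (7, 3), (9, 3), (21, -1)]) τ - 49 * etaQuotient 63 (expFn [(7, 3), (21, -2), (63, 3)]) τ - 7 * etaQuotient 63 (expFn [(1, 3), (3, -2), (9, 3)]) τ - 8 * etaQuotient 63 (expFn [(1, 1), (3, -1), (7, 2), (9, 2), (21, -1), (63, 1)]) τ + 16 * etaQuotient 63 (expFn [(1, 2), (3, -1), (7, 1),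 (9, 1), (21, -1), (63, 2)]) τ) := by
  obtain ⟨E1, hE1, t1⟩ := exists_form_C1
  obtain ⟨E2, hE2, t2⟩ := exists_form_C2
  obtain ⟨E3, hE3, t3⟩ := exists_form_C3
  obtain ⟨E4, hE4, t4⟩ := exists_form_C4
  obtain ⟨E5, hE5, t5⟩ := exists_form_C5
  obtain ⟨E6, hE6, t6⟩ := exists_form_C6
  obtain ⟨E7, hE7, t7⟩ := exists_form_C7
  obtain ⟨E8, hE8, t8⟩ := exists_form_C8
  obtain ⟨E9, hE9, t9⟩ := exists_form_C9
  obtain ⟨E10, hE10, t10⟩ := exists_form_C10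
  obtain ⟨E11, hE11, t11⟩ := exists_form_C11
  obtain ⟨E12, hE12, t12⟩ := exists_form_C12
  have c1 : (⇑E1 : ℍ → ℂ) = etaQuotient 63 (expFn [(1, -2), (3, 6), (7, 2), (9, -2), (21, -2), (63, 2)]) := funext (hE1)
  have c2 : (⇑E2 : ℍ → ℂ) = etaQuotient 63 (expFn [(1, 2), (3, -2), (7, -2), (9, 2), (21, 6), (63, -2)]) := funext (hE2)
  have c3 : (⇑E3 : ℍ → ℂ) = etaQuotient 63 (expFn [(1, -1), (3, 2), (7, 1), (9, 1), (21, 2), (63, -1)]) := funext (hE3)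
  have c4 : (⇑E4 : ℍ → ℂ) = etaQuotient 63 (expFn [(1, -1), (3, 4), (7, 1), (9, -1), (63, 1)]) := funext (hE4)
  have c5 : (⇑E5 : ℍ → ℂ) = etaQuotient 63 (expFn [(1, 1), (7, -1), (9, 1), (21, 4), (63, -1)]) := funext (hE5)
  have c6 : (⇑E6 : ℍ → ℂ) = etaQuotient 63 (expFn [(3, -2), (9, 6)]) := funext (hE6)
  have c7 : (⇑E7 : ℍ → ℂ) = etaQuotient 63 (expFn [(7, 6), (21, -2)]) := funext (hE7)
  have c8 : (⇑E8 : ℍ → ℂ) = etaQuotient 63 (expFn [(3, -1), (7, 3), (9, 3), (21, -1)]) := funext (hE8)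
  have c9 : (⇑E9 : ℍ → ℂ) = etaQuotient 63 (expFn [(7, 3), (21, -2), (63, 3)]) := funext (hE9)
  have c10 : (⇑E10 : ℍ → ℂ) = etaQuotient 63 (expFn [(1, 3), (3, -2), (9, 3)]) := funext (hE10)
  have c11 : (⇑E11 : ℍ → ℂ) = etaQuotient 63 (expFn [(1, 1), (3, -1), (7, 2), (9, 2), (21, -1), (63, 1)]) := funext (hE11)
  have c12 : (⇑E12 : ℍ → ℂ) = etaQuotient 63 (expFn [(1, 2), (3, -1), (7, 1), (9, 1), (21, -1), (63, 2)]) := funext (hE12)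
  have h1 := (⟨by exact_mod_cast coeff_of_table t1 0 (by norm_num) (0) (by decide),
    by exact_mod_cast coeff_of_table t1 1 (by norm_num) (0) (by decide),
    by exact_mod_cast coeff_of_table t1 2 (by norm_num) (0) (by decide),
    by exact_mod_cast coeff_of_table t1 3 (by norm_num) (0) (by decide),
    by exact_mod_cast coeff_of_table t1 4 (by norm_num) (1) (by decide),
    by exact_mod_cast coeff_of_table t1 5 (by norm_num) (2) (by decide),
    by exact_mod_cast coeff_of_table t1 6 (by norm_num) (5) (by decide),
    by exact_mod_cast coeff_of_table t1 7 (by norm_num) (4) (by decide),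
    by exact_mod_cast coeff_of_table t1 8 (by norm_num) (8) (by decide),
    by exact_mod_cast coeff_of_table t1 9 (by norm_num) (6) (by decide),
    by exact_mod_cast coeff_of_table t1 10 (by norm_num) (14) (by decide),
    by exact_mod_cast coeff_of_table t1 11 (by norm_num) (6) (by decide),
    by exact_mod_cast coeff_of_table t1 14 (by norm_num) (17) (by decide),
    by exact_mod_cast coeff_of_table t1 22 (by norm_num) (5) (by decide),
    by exact_mod_cast coeff_of_table t1 25 (by norm_num) (4) (by decide),
    by exact_mod_cast coeff_of_table t1 28 (by norm_num) (39) (by decide)⟩ : (qExpansion 1 ⇑E1).coeff 0 = (0 : ℂ) ∧ (qExpansion 1 ⇑E1).coeff 1 = (0 : ℂ) ∧ (qExpansion 1 ⇑E1).coeff 2 = (0 : ℂ) ∧ (qExpansion 1 ⇑E1).coeff 3 = (0 : ℂ) ∧ (qExpansion 1 ⇑E1).coeff 4 = (1 : ℂ) ∧ (qExpansion 1 ⇑E1).coeff 5 = (2 : ℂ) ∧ (qExpansion 1 ⇑E1).coeff 6 = (5 : ℂ) ∧ (qExpansion 1 ⇑E1).coeff 7 = (4 : ℂ) ∧ (qExpansion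 1 ⇑E1).coeff 8 = (8 : ℂ) ∧ (qExpansion 1 ⇑E1).coeff 9 = (6 : ℂ) ∧ (qExpansion 1 ⇑E1).coeff 10 = (14 : ℂ) ∧ (qExpansion 1 ⇑E1).coeff 11 = (6 : ℂ) ∧ (qExpansion 1 ⇑E1).coeff 14 = (17 : ℂ) ∧ (qExpansion 1 ⇑E1).coeff 22 = (5 : ℂ) ∧ (qExpansion 1 ⇑E1).coeff 25 = (4 : ℂ) ∧ (qExpansion 1 ⇑E1).coeff 28 = (39 : ℂ))
  have h2 := (⟨by exact_mod_cast coeff_of_table t2 0 (by norm_num) (1) (by decide),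
    by exact_mod_cast coeff_of_table t2 1 (by norm_num) (-2) (by decide),
    by exact_mod_cast coeff_of_table t2 2 (by norm_num) (-1) (by decide),
    by exact_mod_cast coeff_of_table t2 3 (by norm_num) (4) (by decide),
    by exact_mod_cast coeff_of_table t2 4 (by norm_num) (-3) (by decide),
    by exact_mod_cast coeff_of_table t2 5 (by norm_num) (0) (by decide),
    by exact_mod_cast coeff_of_table t2 6 (by norm_num) (7) (by decide),
    by exact_mod_cast coeff_of_table t2 7 (by norm_num) (-6) (by decide),
    by exact_mod_cast coeff_of_table t2 8 (by norm_num) (-7) (by decide),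
    by exact_mod_cast coeff_of_table t2 9 (by norm_num) (10) (by decide),
    by exact_mod_cast coeff_of_table t2 10 (by norm_num) (-2) (by decide),
    by exact_mod_cast coeff_of_table t2 11 (by norm_num) (-8) (by decide),
    by exact_mod_cast coeff_of_table t2 14 (by norm_num) (-18) (by decide),
    by exact_mod_cast coeff_of_table t2 22 (by norm_num) (-17) (by decide),
    by exact_mod_cast coeff_of_table t2 25 (by norm_num) (-18) (by decide),
    by exact_mod_cast coeff_of_table t2 28 (by norm_num) (-41) (by decide)⟩ : (qExpansion 1 ⇑E2).coeff 0 = (1 : ℂ) ∧ (qExpansion 1 ⇑E2).coeff 1 = (-2 : ℂ) ∧ (qExpansion 1 ⇑E2).coeff 2 = (-1 : ℂ) ∧ (qExpansion 1 ⇑E2).coeff 3 = (4 : ℂ) ∧ (qExpansion 1 ⇑E2).coeff 4 = (-3 : ℂ) ∧ (qExpansion 1 ⇑E2).coeff 5 = (0 : ℂ) ∧ (qExpansion 1 ⇑E2).coeff 6 = (7 : ℂ) ∧ (qExpansion 1 ⇑E2).coeff 7 = (-6 : ℂ) ∧ (qExpansion 1 ⇑E2).coeff 8 = (-7 : ℂ)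 ∧ (qExpansion 1 ⇑E2).coeff 9 = (10 : ℂ) ∧ (qExpansion 1 ⇑E2).coeff 10 = (-2 : ℂ) ∧ (qExpansion 1 ⇑E2).coeff 11 = (-8 : ℂ) ∧ (qExpansion 1 ⇑E2).coeff 14 = (-18 : ℂ) ∧ (qExpansion 1 ⇑E2).coeff 22 = (-17 : ℂ) ∧ (qExpansion 1 ⇑E2).coeff 25 = (-18 : ℂ) ∧ (qExpansion 1 ⇑E2).coeff 28 = (-41 : ℂ))
  have h3 := (⟨by exact_mod_cast coeff_of_table t3 0 (by norm_num) (1) (by decide),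
    by exact_mod_cast coeff_of_table t3 1 (by norm_num) (1) (by decide),
    by exact_mod_cast coeff_of_table t3 2 (by norm_num) (2) (by decide),
    by exact_mod_cast coeff_of_table t3 3 (by norm_num) (1) (by decide),
    by exact_mod_cast coeff_of_table t3 4 (by norm_num) (3) (by decide),
    by exact_mod_cast coeff_of_table t3 5 (by norm_num) (3) (by decide),
    by exact_mod_cast coeff_of_table t3 6 (by norm_num) (4) (by decide),
    by exact_mod_cast coeff_of_table t3 7 (by norm_num) (3) (by decide),
    by exact_mod_cast coeff_of_table t3 8 (by norm_num) (5) (by decide),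
    by exact_mod_cast coeff_of_table t3 9 (by norm_num) (4) (by decide),
    by exact_mod_cast coeff_of_table t3 10 (by norm_num) (7) (by decide),
    by exact_mod_cast coeff_of_table t3 11 (by norm_num) (4) (by decide),
    by exact_mod_cast coeff_of_table t3 14 (by norm_num) (9) (by decide),
    by exact_mod_cast coeff_of_table t3 22 (by norm_num) (16) (by decide),
    by exact_mod_cast coeff_of_table t3 25 (by norm_num) (15) (by decide),
    by exact_mod_cast coeff_of_table t3 28 (by norm_num) (22) (by decide)⟩ : (qExpansion 1 ⇑E3).coeff 0 = (1 : ℂ) ∧ (qExpansion 1 ⇑E3).coeff 1 = (1 : ℂ) ∧ (qExpansion 1 ⇑E3).coeff 2 = (2 : ℂ) ∧ (qExpansion 1 ⇑E3).coeff 3 = (1 : ℂ) ∧ (qExpansion 1 ⇑E3).coeff 4 = (3 : ℂ) ∧ (qExpansion 1 ⇑E3).coeff 5 = (3 : ℂ) ∧ (qExpansion 1 ⇑E3).coeff 6 = (4 : ℂ) ∧ (qExpansion 1 ⇑E3).coeff 7 = (3 : ℂ) ∧ (qExpansion 1 ⇑E3).coeff 8 = (5 : ℂ) ∧ (qExpansion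 1 ⇑E3).coeff 9 = (4 : ℂ) ∧ (qExpansion 1 ⇑E3).coeff 10 = (7 : ℂ) ∧ (qExpansion 1 ⇑E3).coeff 11 = (4 : ℂ) ∧ (qExpansion 1 ⇑E3).coeff 14 = (9 : ℂ) ∧ (qExpansion 1 ⇑E3).coeff 22 = (16 : ℂ) ∧ (qExpansion 1 ⇑E3).coeff 25 = (15 : ℂ) ∧ (qExpansion 1 ⇑E3).coeff 28 = (22 : ℂ))
  have h4 := (⟨by exact_mod_cast coeff_of_table t4 0 (by norm_num) (0) (by decide),
    by exact_mod_cast coeff_of_table t4 1 (by norm_num) (0) (by decide),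
    by exact_mod_cast coeff_of_table t4 2 (by norm_num) (0) (by decide),
    by exact_mod_cast coeff_of_table t4 3 (by norm_num) (1) (by decide),
    by exact_mod_cast coeff_of_table t4 4 (by norm_num) (1) (by decide),
    by exact_mod_cast coeff_of_table t4 5 (by norm_num) (2) (by decide),
    by exact_mod_cast coeff_of_table t4 6 (by norm_num) (-1) (by decide),
    by exact_mod_cast coeff_of_table t4 7 (by norm_num) (1) (by decide),
    by exact_mod_cast coeff_of_table t4 8 (by norm_num) (-1) (by decide),
    by exact_mod_cast coeff_of_table t4 9 (by norm_num) (1) (by decide),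
    by exact_mod_cast coeff_of_table t4 10 (by norm_num) (-4) (by decide),
    by exact_mod_cast coeff_of_table t4 11 (by norm_num) (-3) (by decide),
    by exact_mod_cast coeff_of_table t4 14 (by norm_num) (-1) (by decide),
    by exact_mod_cast coeff_of_table t4 22 (by norm_num) (5) (by decide),
    by exact_mod_cast coeff_of_table t4 25 (by norm_num) (4) (by decide),
    by exact_mod_cast coeff_of_table t4 28 (by norm_num) (0) (by decide)⟩ : (qExpansion 1 ⇑E4).coeff 0 = (0 : ℂ) ∧ (qExpansion 1 ⇑E4).coeff 1 = (0 : ℂ) ∧ (qExpansion 1 ⇑E4).coeff 2 = (0 : ℂ) ∧ (qExpansion 1 ⇑E4).coeff 3 = (1 : ℂ) ∧ (qExpansion 1 ⇑E4).coeff 4 = (1 : ℂ) ∧ (qExpansion 1 ⇑E4).coeff 5 = (2 : ℂ) ∧ (qExpansion 1 ⇑E4).coeff 6 = (-1 : ℂ) ∧ (qExpansion 1 ⇑E4).coeff 7 = (1 : ℂ) ∧ (qExpansion 1 ⇑E4).coeff 8 = (-1 : ℂ) ∧ (qExpansion 1 ⇑E4).coeff 9 = (1 : ℂ) ∧ (qExpansion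 1 ⇑E4).coeff 10 = (-4 : ℂ) ∧ (qExpansion 1 ⇑E4).coeff 11 = (-3 : ℂ) ∧ (qExpansion 1 ⇑E4).coeff 14 = (-1 : ℂ) ∧ (qExpansion 1 ⇑E4).coeff 22 = (5 : ℂ) ∧ (qExpansion 1 ⇑E4).coeff 25 = (4 : ℂ) ∧ (qExpansion 1 ⇑E4).coeff 28 = (0 : ℂ))
  have h5 := (⟨by exact_mod_cast coeff_of_table t5 0 (by norm_num) (0) (by decide),
    by exact_mod_cast coeff_of_table t5 1 (by norm_num) (1) (by decide),
    by exact_mod_cast coeff_of_table t5 2 (by norm_num) (-1) (by decide),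
    by exact_mod_cast coeff_of_table t5 3 (by norm_num) (-1) (by decide),
    by exact_mod_cast coeff_of_table t5 4 (by norm_num) (0) (by decide),
    by exact_mod_cast coeff_of_table t5 5 (by norm_num) (0) (by decide),
    by exact_mod_cast coeff_of_table t5 6 (by norm_num) (1) (by decide),
    by exact_mod_cast coeff_of_table t5 7 (by norm_num) (0) (by decide),
    by exact_mod_cast coeff_of_table t5 8 (by norm_num) (2) (by decide),
    by exact_mod_cast coeff_of_table t5 9 (by norm_num) (-1) (by decide),
    by exact_mod_cast coeff_of_table t5 10 (by norm_num) (-2) (by decide),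
    by exact_mod_cast coeff_of_table t5 11 (by norm_num) (1) (by decide),
    by exact_mod_cast coeff_of_table t5 14 (by norm_num) (0) (by decide),
    by exact_mod_cast coeff_of_table t5 22 (by norm_num) (1) (by decide),
    by exact_mod_cast coeff_of_table t5 25 (by norm_num) (3) (by decide),
    by exact_mod_cast coeff_of_table t5 28 (by norm_num) (1) (by decide)⟩ : (qExpansion 1 ⇑E5).coeff 0 = (0 : ℂ) ∧ (qExpansion 1 ⇑E5).coeff 1 = (1 : ℂ) ∧ (qExpansion 1 ⇑E5).coeff 2 = (-1 : ℂ) ∧ (qExpansion 1 ⇑E5).coeff 3 = (-1 : ℂ) ∧ (qExpansion 1 ⇑E5).coeff 4 = (0 : ℂ) ∧ (qExpansion 1 ⇑E5).coeff 5 = (0 : ℂ) ∧ (qExpansion 1 ⇑E5).coeff 6 = (1 : ℂ) ∧ (qExpansion 1 ⇑E5).coeff 7 = (0 : ℂ) ∧ (qExpansion 1 ⇑E5).coeff 8 = (2 : ℂ) ∧ (qExpansion 1 ⇑E5).coeff 9 = (-1 : ℂ) ∧ (qExpansion 1 ⇑E5).coeff 10 = (-2 : ℂ) ∧ (qExpansion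 1 ⇑E5).coeff 11 = (1 : ℂ) ∧ (qExpansion 1 ⇑E5).coeff 14 = (0 : ℂ) ∧ (qExpansion 1 ⇑E5).coeff 22 = (1 : ℂ) ∧ (qExpansion 1 ⇑E5).coeff 25 = (3 : ℂ) ∧ (qExpansion 1 ⇑E5).coeff 28 = (1 : ℂ))
  have h6 := (⟨by exact_mod_cast coeff_of_table t6 0 (by norm_num) (0) (by decide),
    by exact_mod_cast coeff_of_table t6 1 (by norm_num) (0) (by decide),
    by exact_mod_cast coeff_of_table t6 2 (by norm_num) (1) (by decide),
    by exact_mod_cast coeff_of_table t6 3 (by norm_num) (0) (by decide),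
    by exact_mod_cast coeff_of_table t6 4 (by norm_num) (0) (by decide),
    by exact_mod_cast coeff_of_table t6 5 (by norm_num) (2) (by decide),
    by exact_mod_cast coeff_of_table t6 6 (by norm_num) (0) (by decide),
    by exact_mod_cast coeff_of_table t6 7 (by norm_num) (0) (by decide),
    by exact_mod_cast coeff_of_table t6 8 (by norm_num) (5) (by decide),
    by exact_mod_cast coeff_of_table t6 9 (by norm_num) (0) (by decide),
    by exact_mod_cast coeff_of_table t6 10 (by norm_num) (0) (by decide),
    by exact_mod_cast coeff_of_table t6 11 (by norm_num) (4) (by decide),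
    by exact_mod_cast coeff_of_table t6 14 (by norm_num) (8) (by decide),
    by exact_mod_cast coeff_of_table t6 22 (by norm_num) (0) (by decide),
    by exact_mod_cast coeff_of_table t6 25 (by norm_num) (0) (by decide),
    by exact_mod_cast coeff_of_table t6 28 (by norm_num) (0) (by decide)⟩ : (qExpansion 1 ⇑E6).coeff 0 = (0 : ℂ) ∧ (qExpansion 1 ⇑E6).coeff 1 = (0 : ℂ) ∧ (qExpansion 1 ⇑E6).coeff 2 = (1 : ℂ) ∧ (qExpansion 1 ⇑E6).coeff 3 = (0 : ℂ) ∧ (qExpansion 1 ⇑E6).coeff 4 = (0 : ℂ) ∧ (qExpansion 1 ⇑E6).coeff 5 = (2 : ℂ) ∧ (qExpansion 1 ⇑E6).coeff 6 = (0 : ℂ) ∧ (qExpansion 1 ⇑E6).coeff 7 = (0 : ℂ) ∧ (qExpansion 1 ⇑E6).coeff 8 = (5 : ℂ) ∧ (qExpansion 1 ⇑E6).coeff 9 = (0 : ℂ) ∧ (qExpansion 1 ⇑E6).coeff 10 = (0 : ℂ) ∧ (qExpansion 1 ⇑E6).coeff 11 = (4 : ℂ) ∧ (qExpansion 1 ⇑E6).coeff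 14 = (8 : ℂ) ∧ (qExpansion 1 ⇑E6).coeff 22 = (0 : ℂ) ∧ (qExpansion 1 ⇑E6).coeff 25 = (0 : ℂ) ∧ (qExpansion 1 ⇑E6).coeff 28 = (0 : ℂ))
  have h7 := (⟨by exact_mod_cast coeff_of_table t7 0 (by norm_num) (1) (by decide),
    by exact_mod_cast coeff_of_table t7 1 (by norm_num) (0) (by decide),
    by exact_mod_cast coeff_of_table t7 2 (by norm_num) (0) (by decide),
    by exact_mod_cast coeff_of_table t7 3 (by norm_num) (0) (by decide),
    by exact_mod_cast coeff_of_table t7 4 (by norm_num) (0) (by decide),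
    by exact_mod_cast coeff_of_table t7 5 (by norm_num) (0) (by decide),
    by exact_mod_cast coeff_of_table t7 6 (by norm_num) (0) (by decide),
    by exact_mod_cast coeff_of_table t7 7 (by norm_num) (-6) (by decide),
    by exact_mod_cast coeff_of_table t7 8 (by norm_num) (0) (by decide),
    by exact_mod_cast coeff_of_table t7 9 (by norm_num) (0) (by decide),
    by exact_mod_cast coeff_of_table t7 10 (by norm_num) (0) (by decide),
    by exact_mod_cast coeff_of_table t7 11 (by norm_num) (0) (by decide),
    by exact_mod_cast coeff_of_table t7 14 (by norm_num) (9) (by decide),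
    by exact_mod_cast coeff_of_table t7 22 (by norm_num) (0) (by decide),
    by exact_mod_cast coeff_of_table t7 25 (by norm_num) (0) (by decide),
    by exact_mod_cast coeff_of_table t7 28 (by norm_num) (-42) (by decide)⟩ : (qExpansion 1 ⇑E7).coeff 0 = (1 : ℂ) ∧ (qExpansion 1 ⇑E7).coeff 1 = (0 : ℂ) ∧ (qExpansion 1 ⇑E7).coeff 2 = (0 : ℂ) ∧ (qExpansion 1 ⇑E7).coeff 3 = (0 : ℂ) ∧ (qExpansion 1 ⇑E7).coeff 4 = (0 : ℂ) ∧ (qExpansion 1 ⇑E7).coeff 5 = (0 : ℂ) ∧ (qExpansion 1 ⇑E7).coeff 6 = (0 : ℂ) ∧ (qExpansion 1 ⇑E7).coeff 7 = (-6 : ℂ) ∧ (qExpansion 1 ⇑E7).coeff 8 = (0 : ℂ) ∧ (qExpansion 1 ⇑E7).coeff 9 = (0 : ℂ) ∧ (qExpansion 1 ⇑E7).coeff 10 = (0 : ℂ) ∧ (qExpansion 1 ⇑E7).coeff 11 = (0 : ℂ) ∧ (qExpansion 1 ⇑E7).coeff 14 = (9 : ℂ) ∧ (qExpansion 1 ⇑E7).coeff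 22 = (0 : ℂ) ∧ (qExpansion 1 ⇑E7).coeff 25 = (0 : ℂ) ∧ (qExpansion 1 ⇑E7).coeff 28 = (-42 : ℂ))
  have h8 := (⟨by exact_mod_cast coeff_of_table t8 0 (by norm_num) (0) (by decide),
    by exact_mod_cast coeff_of_table t8 1 (by norm_num) (1) (by decide),
    by exact_mod_cast coeff_of_table t8 2 (by norm_num) (0) (by decide),
    by exact_mod_cast coeff_of_table t8 3 (by norm_num) (0) (by decide),
    by exact_mod_cast coeff_of_table t8 4 (by norm_num) (1) (by decide),
    by exact_mod_cast coeff_of_table t8 5 (by norm_num) (0) (by decide),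
    by exact_mod_cast coeff_of_table t8 6 (by norm_num) (0) (by decide),
    by exact_mod_cast coeff_of_table t8 7 (by norm_num) (2) (by decide),
    by exact_mod_cast coeff_of_table t8 8 (by norm_num) (-3) (by decide),
    by exact_mod_cast coeff_of_table t8 9 (by norm_num) (0) (by decide),
    by exact_mod_cast coeff_of_table t8 10 (by norm_num) (0) (by decide),
    by exact_mod_cast coeff_of_table t8 11 (by norm_num) (-3) (by decide),
    by exact_mod_cast coeff_of_table t8 14 (by norm_num) (-6) (by decide),
    by exact_mod_cast coeff_of_table t8 22 (by norm_num) (6) (by decide),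
    by exact_mod_cast coeff_of_table t8 25 (by norm_num) (7) (by decide),
    by exact_mod_cast coeff_of_table t8 28 (by norm_num) (14) (by decide)⟩ : (qExpansion 1 ⇑E8).coeff 0 = (0 : ℂ) ∧ (qExpansion 1 ⇑E8).coeff 1 = (1 : ℂ) ∧ (qExpansion 1 ⇑E8).coeff 2 = (0 : ℂ) ∧ (qExpansion 1 ⇑E8).coeff 3 = (0 : ℂ) ∧ (qExpansion 1 ⇑E8).coeff 4 = (1 : ℂ) ∧ (qExpansion 1 ⇑E8).coeff 5 = (0 : ℂ) ∧ (qExpansion 1 ⇑E8).coeff 6 = (0 : ℂ) ∧ (qExpansion 1 ⇑E8).coeff 7 = (2 : ℂ) ∧ (qExpansion 1 ⇑E8).coeff 8 = (-3 : ℂ) ∧ (qExpansion 1 ⇑E8).coeff 9 = (0 : ℂ) ∧ (qExpansion 1 ⇑E8).coeff 10 = (0 : ℂ) ∧ (qExpansion 1 ⇑E8).coeff 11 = (-3 : ℂ) ∧ (qExpansion 1 ⇑E8).coeff 14 = (-6 : ℂ) ∧ (qExpansion 1 ⇑E8).coeff 22 = (6 : ℂ) ∧ (qExpansion 1 ⇑E8).coeff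 25 = (7 : ℂ) ∧ (qExpansion 1 ⇑E8).coeff 28 = (14 : ℂ))
  have h9 := (⟨by exact_mod_cast coeff_of_table t9 0 (by norm_num) (0) (by decide),
    by exact_mod_cast coeff_of_table t9 1 (by norm_num) (0) (by decide),
    by exact_mod_cast coeff_of_table t9 2 (by norm_num) (0) (by decide),
    by exact_mod_cast coeff_of_table t9 3 (by norm_num) (0) (by decide),
    by exact_mod_cast coeff_of_table t9 4 (by norm_num) (0) (by decide),
    by exact_mod_cast coeff_of_table t9 5 (by norm_num) (0) (by decide),
    by exact_mod_cast coeff_of_table t9 6 (by norm_num) (0) (by decide),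
    by exact_mod_cast coeff_of_table t9 7 (by norm_num) (1) (by decide),
    by exact_mod_cast coeff_of_table t9 8 (by norm_num) (0) (by decide),
    by exact_mod_cast coeff_of_table t9 9 (by norm_num) (0) (by decide),
    by exact_mod_cast coeff_of_table t9 10 (by norm_num) (0) (by decide),
    by exact_mod_cast coeff_of_table t9 11 (by norm_num) (0) (by decide),
    by exact_mod_cast coeff_of_table t9 14 (by norm_num) (-3) (by decide),
    by exact_mod_cast coeff_of_table t9 22 (by norm_num) (0) (by decide),
    by exact_mod_cast coeff_of_table t9 25 (by norm_num) (0) (by decide),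
    by exact_mod_cast coeff_of_table t9 28 (by norm_num) (7) (by decide)⟩ : (qExpansion 1 ⇑E9).coeff 0 = (0 : ℂ) ∧ (qExpansion 1 ⇑E9).coeff 1 = (0 : ℂ) ∧ (qExpansion 1 ⇑E9).coeff 2 = (0 : ℂ) ∧ (qExpansion 1 ⇑E9).coeff 3 = (0 : ℂ) ∧ (qExpansion 1 ⇑E9).coeff 4 = (0 : ℂ) ∧ (qExpansion 1 ⇑E9).coeff 5 = (0 : ℂ) ∧ (qExpansion 1 ⇑E9).coeff 6 = (0 : ℂ) ∧ (qExpansion 1 ⇑E9).coeff 7 = (1 : ℂ) ∧ (qExpansion 1 ⇑E9).coeff 8 = (0 : ℂ) ∧ (qExpansion 1 ⇑E9).coeff 9 = (0 : ℂ) ∧ (qExpansion 1 ⇑E9).coeff 10 = (0 : ℂ) ∧ (qExpansion 1 ⇑E9).coeff 11 = (0 : ℂ) ∧ (qExpansion 1 ⇑E9).coeff 14 = (-3 : ℂ) ∧ (qExpansion 1 ⇑E9).coeff 22 = (0 : ℂ) ∧ (qExpansion 1 ⇑E9).coeff 25 = (0 : ℂ) ∧ (qExpansion 1 ⇑E9).coeff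 28 = (7 : ℂ))
  have h10 := (⟨by exact_mod_cast coeff_of_table t10 0 (by norm_num) (0) (by decide),
    by exact_mod_cast coeff_of_table t10 1 (by norm_num) (1) (by decide),
    by exact_mod_cast coeff_of_table t10 2 (by norm_num) (-3) (by decide),
    by exact_mod_cast coeff_of_table t10 3 (by norm_num) (0) (by decide),
    by exact_mod_cast coeff_of_table t10 4 (by norm_num) (7) (by decide),
    by exact_mod_cast coeff_of_table t10 5 (by norm_num) (-6) (by decide),
    by exact_mod_cast coeff_of_table t10 6 (by norm_num) (0) (by decide),
    by exact_mod_cast coeff_of_table t10 7 (by norm_num) (8) (by decide),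
    by exact_mod_cast coeff_of_table t10 8 (by norm_num) (-15) (by decide),
    by exact_mod_cast coeff_of_table t10 9 (by norm_num) (0) (by decide),
    by exact_mod_cast coeff_of_table t10 10 (by norm_num) (18) (by decide),
    by exact_mod_cast coeff_of_table t10 11 (by norm_num) (-12) (by decide),
    by exact_mod_cast coeff_of_table t10 14 (by norm_num) (-24) (by decide),
    by exact_mod_cast coeff_of_table t10 22 (by norm_num) (36) (by decide),
    by exact_mod_cast coeff_of_table t10 25 (by norm_num) (31) (by decide),
    by exact_mod_cast coeff_of_table t10 28 (by norm_num) (56) (by decide)⟩ : (qExpansion 1 ⇑E10).coeff 0 = (0 : ℂ) ∧ (qExpansion 1 ⇑E10).coeff 1 = (1 : ℂ) ∧ (qExpansion 1 ⇑E10).coeff 2 = (-3 : ℂ) ∧ (qExpansion 1 ⇑E10).coeff 3 = (0 : ℂ) ∧ (qExpansion 1 ⇑E10).coeff 4 = (7 : ℂ) ∧ (qExpansion 1 ⇑E10).coeff 5 = (-6 : ℂ) ∧ (qExpansion 1 ⇑E10).coeff 6 = (0 : ℂ) ∧ (qExpansion 1 ⇑E10).coeff 7 = (8 : ℂ) ∧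 (qExpansion 1 ⇑E10).coeff 8 = (-15 : ℂ) ∧ (qExpansion 1 ⇑E10).coeff 9 = (0 : ℂ) ∧ (qExpansion 1 ⇑E10).coeff 10 = (18 : ℂ) ∧ (qExpansion 1 ⇑E10).coeff 11 = (-12 : ℂ) ∧ (qExpansion 1 ⇑E10).coeff 14 = (-24 : ℂ) ∧ (qExpansion 1 ⇑E10).coeff 22 = (36 : ℂ) ∧ (qExpansion 1 ⇑E10).coeff 25 = (31 : ℂ) ∧ (qExpansion 1 ⇑E10).coeff 28 = (56 : ℂ))
  have h11 := (⟨by exact_mod_cast coeff_of_table t11 0 (by norm_num) (0) (by decide),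
    by exact_mod_cast coeff_of_table t11 1 (by norm_num) (0) (by decide),
    by exact_mod_cast coeff_of_table t11 2 (by norm_num) (0) (by decide),
    by exact_mod_cast coeff_of_table t11 3 (by norm_num) (1) (by decide),
    by exact_mod_cast coeff_of_table t11 4 (by norm_num) (-1) (by decide),
    by exact_mod_cast coeff_of_table t11 5 (by norm_num) (-1) (by decide),
    by exact_mod_cast coeff_of_table t11 6 (by norm_num) (1) (by decide),
    by exact_mod_cast coeff_of_table t11 7 (by norm_num) (-1) (by decide),
    by exact_mod_cast coeff_of_table t11 8 (by norm_num) (0) (by decide),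
    by exact_mod_cast coeff_of_table t11 9 (by norm_num) (2) (by decide),
    by exact_mod_cast coeff_of_table t11 10 (by norm_num) (-3) (by decide),
    by exact_mod_cast coeff_of_table t11 11 (by norm_num) (1) (by decide),
    by exact_mod_cast coeff_of_table t11 14 (by norm_num) (3) (by decide),
    by exact_mod_cast coeff_of_table t11 22 (by norm_num) (-5) (by decide),
    by exact_mod_cast coeff_of_table t11 25 (by norm_num) (-4) (by decide),
    by exact_mod_cast coeff_of_table t11 28 (by norm_num) (-7) (by decide)⟩ : (qExpansion 1 ⇑E11).coeff 0 = (0 : ℂ) ∧ (qExpansion 1 ⇑E11).coeff 1 = (0 : ℂ) ∧ (qExpansion 1 ⇑E11).coeff 2 = (0 : ℂ) ∧ (qExpansion 1 ⇑E11).coeff 3 = (1 : ℂ) ∧ (qExpansion 1 ⇑E11).coeff 4 = (-1 : ℂ) ∧ (qExpansion 1 ⇑E11).coeff 5 = (-1 : ℂ) ∧ (qExpansion 1 ⇑E11).coeff 6 = (1 : ℂ) ∧ (qExpansion 1 ⇑E11).coeff 7 = (-1 : ℂ) ∧ (qExpansion 1 ⇑E11).coeff 8 = (0 : ℂ) ∧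 (qExpansion 1 ⇑E11).coeff 9 = (2 : ℂ) ∧ (qExpansion 1 ⇑E11).coeff 10 = (-3 : ℂ) ∧ (qExpansion 1 ⇑E11).coeff 11 = (1 : ℂ) ∧ (qExpansion 1 ⇑E11).coeff 14 = (3 : ℂ) ∧ (qExpansion 1 ⇑E11).coeff 22 = (-5 : ℂ) ∧ (qExpansion 1 ⇑E11).coeff 25 = (-4 : ℂ) ∧ (qExpansion 1 ⇑E11).coeff 28 = (-7 : ℂ))
  have h12 := (⟨by exact_mod_cast coeff_of_table t12 0 (by norm_num) (0) (by decide),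
    by exact_mod_cast coeff_of_table t12 1 (by norm_num) (0) (by decide),
    by exact_mod_cast coeff_of_table t12 2 (by norm_num) (0) (by decide),
    by exact_mod_cast coeff_of_table t12 3 (by norm_num) (0) (by decide),
    by exact_mod_cast coeff_of_table t12 4 (by norm_num) (0) (by decide),
    by exact_mod_cast coeff_of_table t12 5 (by norm_num) (1) (by decide),
    by exact_mod_cast coeff_of_table t12 6 (by norm_num) (-2) (by decide),
    by exact_mod_cast coeff_of_table t12 7 (by norm_num) (-1) (by decide),
    by exact_mod_cast coeff_of_table t12 8 (by norm_num) (3) (by decide),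
    by exact_mod_cast coeff_of_table t12 9 (by norm_num) (-1) (by decide),
    by exact_mod_cast coeff_of_table t12 10 (by norm_num) (1) (by decide),
    by exact_mod_cast coeff_of_table t12 11 (by norm_num) (2) (by decide),
    by exact_mod_cast coeff_of_table t12 14 (by norm_num) (3) (by decide),
    by exact_mod_cast coeff_of_table t12 22 (by norm_num) (0) (by decide),
    by exact_mod_cast coeff_of_table t12 25 (by norm_num) (0) (by decide),
    by exact_mod_cast coeff_of_table t12 28 (by norm_num) (-6) (by decide)⟩ : (qExpansion 1 ⇑E12).coeff 0 = (0 : ℂ) ∧ (qExpansion 1 ⇑E12).coeff 1 = (0 : ℂ) ∧ (qExpansion 1 ⇑E12).coeff 2 = (0 : ℂ) ∧ (qExpansion 1 ⇑E12).coeff 3 = (0 : ℂ) ∧ (qExpansion 1 ⇑E12).coeff 4 = (0 : ℂ) ∧ (qExpansion 1 ⇑E12).coeff 5 = (1 : ℂ) ∧ (qExpansion 1 ⇑E12).coeff 6 = (-2 : ℂ) ∧ (qExpansion 1 ⇑E12).coeff 7 = (-1 : ℂ) ∧ (qExpansion 1 ⇑E12).coeff 8 = (3 : ℂ) ∧ (qExpansion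 1 ⇑E12).coeff 9 = (-1 : ℂ) ∧ (qExpansion 1 ⇑E12).coeff 10 = (1 : ℂ) ∧ (qExpansion 1 ⇑E12).coeff 11 = (2 : ℂ) ∧ (qExpansion 1 ⇑E12).coeff 14 = (3 : ℂ) ∧ (qExpansion 1 ⇑E12).coeff 22 = (0 : ℂ) ∧ (qExpansion 1 ⇑E12).coeff 25 = (0 : ℂ) ∧ (qExpansion 1 ⇑E12).coeff 28 = (-6 : ℂ))
  have w1 : (⇑E1 : ℍ → ℂ) ∣[(2 : ℤ)] (glCast (frickeGL 63 : GL (Fin 2) ℚ) : GL (Fin 2) ℝ) = ((-1 : ℂ)) • (⇑E2 : ℍ → ℂ) := by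
    rw [c1, c2]; exact slash_C1
  have w2 : (⇑E2 : ℍ → ℂ) ∣[(2 : ℤ)] (glCast (frickeGL 63 : GL (Fin 2) ℚ) : GL (Fin 2) ℝ) = ((-1 : ℂ)) • (⇑E1 : ℍ → ℂ) := by
    rw [c2, c1]; exact slash_C2
  have w3 : (⇑E3 : ℍ → ℂ) ∣[(2 : ℤ)] (glCast (frickeGL 63 : GL (Fin 2) ℚ) : GL (Fin 2) ℝ) = ((-1 : ℂ)) • (⇑E3 : ℍ → ℂ) := by
    rw [c3]; exact slash_C3
  have w4 : (⇑E4 : ℍ → ℂ) ∣[(2 : ℤ)] (glCast (frickeGL 63 : GL (Fin 2) ℚ) : GL (Fin 2) ℝ) = ((-1 : ℂ)) • (⇑E5 : ℍ → ℂ) := by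
    rw [c4, c5]; exact slash_C4
  have w5 : (⇑E5 : ℍ → ℂ) ∣[(2 : ℤ)] (glCast (frickeGL 63 : GL (Fin 2) ℚ) : GL (Fin 2) ℝ) = ((-1 : ℂ)) • (⇑E4 : ℍ → ℂ) := by
    rw [c5, c4]; exact slash_C5
  have w6 : (⇑E6 : ℍ → ℂ) ∣[(2 : ℤ)] (glCast (frickeGL 63 : GL (Fin 2) ℚ) : GL (Fin 2) ℝ) = (((-7 : ℂ) / 27)) • (⇑E7 : ℍ → ℂ) := by
    rw [c6, c7, slash_C6]; congr 1; norm_num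
  have w7 : (⇑E7 : ℍ → ℂ) ∣[(2 : ℤ)] (glCast (frickeGL 63 : GL (Fin 2) ℚ) : GL (Fin 2) ℝ) = (((-27 : ℂ) / 7)) • (⇑E6 : ℍ → ℂ) := by
    rw [c7, c6, slash_C7]; congr 1; norm_num
  have w8 : (⇑E8 : ℍ → ℂ) ∣[(2 : ℤ)] (glCast (frickeGL 63 : GL (Fin 2) ℚ) : GL (Fin 2) ℝ) = ((-1 : ℂ)) • (⇑E8 : ℍ → ℂ) := by
    rw [c8]; exact slash_C8
  have w9 : (⇑E9 : ℍ → ℂ) ∣[(2 : ℤ)] (glCast (frickeGL 63 : GL (Fin 2) ℚ) : GL (Fin 2) ℝ) = (((-1 : ℂ) / 7)) • (⇑E10 : ℍ → ℂ) := by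
    rw [c9, c10, slash_C9]; congr 1; norm_num
  have w10 : (⇑E10 : ℍ → ℂ) ∣[(2 : ℤ)] (glCast (frickeGL 63 : GL (Fin 2) ℚ) : GL (Fin 2) ℝ) = ((-7 : ℂ)) • (⇑E9 : ℍ → ℂ) := by
    rw [c10, c9]; exact slash_C10
  have w11 : (⇑E11 : ℍ → ℂ) ∣[(2 : ℤ)] (glCast (frickeGL 63 : GL (Fin 2) ℚ) : GL (Fin 2) ℝ) = ((-1 : ℂ)) • (⇑E11 : ℍ → ℂ) := by
    rw [c11]; exact slash_C11
  have w12 : (⇑E12 : ℍ → ℂ) ∣[(2 : ℤ)] (glCast (frickeGL 63 : GL (Fin 2) ℚ) : GL (Fin 2) ℝ) = ((-1 : ℂ)) • (⇑E12 : ℍ → ℂ) := by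
    rw [c12]; exact slash_C12
  have hpin := f_toModularForm_eq_sixtyThree_of_basis h1 h2 h3 h4 h5 h6 h7 h8 h9 h10 h11 h12 D
    w1 w2 w3 w4 w5 w6 w7 w8 w9 w10 w11 w12
  have hcoe : (⇑D.f : ℍ → ℂ) = ∑ i, ![(-2 : ℂ), (-2 : ℂ), (16 : ℂ), (0 : ℂ), (0 : ℂ), (-54 : ℂ), (-14 : ℂ), (-12 : ℂ), (-49 : ℂ), (-7 : ℂ), (-8 : ℂ), (16 : ℂ)] i • (⇑(![E1, E2, E3, E4, E5, E6, E7, E8, E9, E10, E11, E12] i) : ℍ → ℂ) := by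
    have h := congrArg (fun H : ModularForm (Gamma0 63) 2 ↦ (⇑H : ℍ → ℂ)) hpin
    have hF' : (⇑(CuspForm.toModularFormₗ D.f) : ℍ → ℂ) = ⇑D.f := _root_.funext (CuspForm.toModularFormₗ_apply D.f)
    simp only [hF', coe_sum_smul63] at h
    exact h
  rw [hcoe]
  funext τ
  simp only [Finset.sum_apply, Pi.smul_apply, smul_eq_mul, Fin.sum_univ_succ, Fin.sum_univ_zero, Matrix.cons_val_zero, Matrix.cons_val_succ,
    Fin.isValue, hE1, hE2, hE3, hE4, hE5, hE6, hE7, hE8, hE9, hE10, hE11, hE12]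
  norm_num
  ring

/-! ## §3 The headline: `|c| = 1`, `3 ∤ c`, `p ∤ c` on `X₀(63)`, unconditionally -/

/-- **`|c| = 1` for every lattice-optimal `X₀(63)`-datum of every globally minimal elliptic `W/ℚ`** — UNCONDITIONAL (pinning by the Fricke sieve + the
Bracket–Sturm certificate of `63a` with the Néron lattice of `63a1`).  The first `9 ∥ N` level of the C3 domain whose old forms do NOT come from an `η`-quotient
newform. [cite: Manin1972, Prop. 1.4] [cite: AgasheRibetStein2006, §§1–2] [cite: CremonaAlgorithms1997, §2.10, Table 1 (63a1)] -/
theorem abs_maninConstant_eq_one_sixtyThree (W : WeierstrassCurve ℚ) [W.IsElliptic] [W.IsGloballyMinimal]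
    (D : ModularParametrizationData W 63) (hopt : ∀ z ∈ D.L.lattice, ∃ w ∈ periodLattice D.f, z = D.c * w) :
    |D.maninConstant| = 1 :=
  abs_maninConstant_eq_one_sixtyThree_of_pinned W D hopt (f_apply_eq_sixtyThree D)

/-- **C3 `ManinPrimeToThreeAtNine` at `N = 63` (`3² ∣ 63`): `3 ∤ c(D)`** for every lattice-optimal `X₀(63)`-datum — UNCONDITIONAL. [cite: AgasheRibetStein2006, §§1–2] -/
theorem not_three_dvd_maninConstant_sixtyThree (W : WeierstrassCurve ℚ) [W.IsElliptic] [W.IsGloballyMinimal]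
    (D : ModularParametrizationData W 63) (hopt : ∀ z ∈ D.L.lattice, ∃ w ∈ periodLattice D.f, z = D.c * w) :
    ¬ (3 : ℤ) ∣ D.maninConstant :=
  not_three_dvd_maninConstant_sixtyThree_of_pinned W D hopt (f_apply_eq_sixtyThree D)

/-- **No prime divides `c` on `X₀(63)`.** [cite: AgasheRibetStein2006, §§1–2] -/
theorem not_prime_dvd_maninConstant_sixtyThree (W : WeierstrassCurve ℚ) [W.IsElliptic] [W.IsGloballyMinimal]
    (D : ModularParametrizationData W 63) (hopt : ∀ z ∈ D.L.lattice, ∃ w ∈ periodLattice D.f, z = D.c * w)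
    {p : ℕ} (hp : p.Prime) : ¬ (p : ℤ) ∣ D.maninConstant := by
  have h := abs_maninConstant_eq_one_sixtyThree W D hopt
  intro hpd
  have h1 := Int.le_of_dvd (by rw [h]; norm_num) ((dvd_abs _ _).mpr hpd)
  rw [h] at h1
  have := hp.two_le
  omega

/-- **The C3 conclusion on the whole `X₀(63)`-domain**: `3² ∣ 63`, and `|c| = 1 ∧ 3 ∤ c` for every lattice-optimal `X₀(63)`-datum of every globally
minimal elliptic curve over `ℚ` — UNCONDITIONAL; BSD and C3 for general `N` are NOT proved by this. [folklore] -/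
theorem maninPrimeToThreeAtNine_sixtyThree :
    3 ^ 2 ∣ 63 ∧ ∀ (W : WeierstrassCurve ℚ) [W.IsElliptic] [W.IsGloballyMinimal] (D : ModularParametrizationData W 63),
      (∀ z ∈ D.L.lattice, ∃ w ∈ periodLattice D.f, z = D.c * w) → |D.maninConstant| = 1 ∧ ¬ (3 : ℤ) ∣ D.maninConstant :=
  ⟨⟨7, by norm_num⟩, fun W _ _ D hopt ↦
    ⟨abs_maninConstant_eq_one_sixtyThree W D hopt, not_three_dvd_maninConstant_sixtyThree W D hopt⟩⟩

/-! ## §4 The domain is inhabited under the item's binder `exists_isNewformOf` -/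

/-- **Modularity at `63a1`, levelled**: under `exists_isNewformOf` the curve `[1, −1, 0, 9, 0]` has a newform in `S₂(Γ₀(63))` (its conductor IS `63`,
`conductorNorm_sixtyThreeA1`).  CONDITIONAL on the item's own binder. [cite: DiamondShurman2005, Thm. 8.8.3] -/
theorem exists_isNewformOf_sixtyThreeA1 (hnf : exists_isNewformOf) :
    ∃ f : CuspForm (Gamma0 63) 2, IsNewformOf (⟨1, -1, 0, 9, 0⟩ : WeierstrassCurve ℚ) f := by
  haveI := isElliptic_sixtyThreeA1
  have key : ∀ (N : ℕ) [NeZero N], (⟨1, -1, 0, 9, 0⟩ : WeierstrassCurve ℚ).conductorNorm ℤ = N →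
      ∃ f : CuspForm (Gamma0 N) 2, IsNewformOf (⟨1, -1, 0, 9, 0⟩ : WeierstrassCurve ℚ) f := by
    intro N _ hN
    subst hN
    exact hnf _
  haveI : NeZero (63 : ℕ) := ⟨by decide⟩
  exact key 63 conductorNorm_sixtyThreeA1

/-- **A lattice-optimal `X₀(63)`-datum on a globally minimal model in the class `63a` exists under modularity**, with `|c| = 1` and `3 ∤ c`; CONDITIONAL on
`exists_isNewformOf` only. [cite: EdixhovenManin1991, Prop. 2] -/
theorem domain_inhabited_sixtyThree_of_modularity (hnf : exists_isNewformOf) :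
    ∃ (W₀ : WeierstrassCurve ℚ) (_ : W₀.IsElliptic) (_ : W₀.IsGloballyMinimal) (D₀ : ModularParametrizationData W₀ 63),
      (⟨1, -1, 0, 9, 0⟩ : WeierstrassCurve ℚ).IsIsogenous W₀ ∧ (∀ z ∈ D₀.L.lattice, ∃ w ∈ periodLattice D₀.f, z = D₀.c * w) ∧
      |D₀.maninConstant| = 1 ∧ ¬ (3 : ℤ) ∣ D₀.maninConstant := by
  haveI := isElliptic_sixtyThreeA1
  haveI : NeZero (63 : ℕ) := ⟨by decide⟩
  obtain ⟨f, hf⟩ := exists_isNewformOf_sixtyThreeA1 hnf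
  obtain ⟨D⟩ := nonempty_modularParametrizationData_of_isNewformOf hf
  obtain ⟨W₀, h₀, hmin, D₀, -, hiso, hopt, -⟩ :=
    ExistsMinimalOptimalDatum.existsMinimalOptimalDatum_full (⟨1, -1, 0, 9, 0⟩ : WeierstrassCurve ℚ) D
  exact ⟨W₀, h₀, hmin, D₀, hiso, hopt, @abs_maninConstant_eq_one_sixtyThree W₀ h₀ hmin D₀ hopt,
    @not_three_dvd_maninConstant_sixtyThree W₀ h₀ hmin D₀ hopt⟩

end Summit.BirchSwinnertonDyer.BirchSwinnertonDyer.Theorems.ManinLocalTwoThree.LevelSixtyThree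

end
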